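import Summits.AnomalousDissipation.AnomalousDissipation.Theorems.SolenoidalFractalHomogenisationRealisedQuasiStaticCellLawUpperSomeInvariant
import Summits.AnomalousDissipation.AnomalousDissipation.Theorems.SolenoidalFractalHomogenisationRealisedQuasiStaticCellLawUpperSomePeriodSum
import Summits.AnomalousDissipation.AnomalousDissipation.Theorems.SolenoidalFractalHomogenisationRealisedQuasiStaticCellLawUpperSomeCosine
import HarnessLib

/-!
# K2R `RealisedQuasiStaticCellLaw`, line `floquet-bloch`, stub `stub_upperSome`: one period of the principal pair — the
# LOWER log law with the isotropic exponent (drift-corrected), the cone at the next period, the interior bound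

Summits-side helper (everything proved; no definitions, no named facts; `--supports stmt-AnomalousDissipation-20446`).
`upperSome_period`: `upperSome_slot_step` over the `k₀` slots of period `q` (cone supplied by `upperSome_period_invariant`),
the log steps telescoped, the polarisation weights summed against the isotropy identity with the drift of the slow direction
(`period_weighted_sum_le`). Energy LOWER-bound half of the K2R bracket; not anomalous dissipation.
-/

set_option linter.dupNamespace false -- layout D-0017: `AnomalousDissipation.AnomalousDissipation` repeats by design

noncomputable section

namespace Summit.AnomalousDissipation.AnomalousDissipation.Theorems.SolenoidalFractalHomogenisation.RealisedQuasiStaticCellLaw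

open Set MeasureTheory Filter Topology Function Complex Matrix
open scoped InnerProductSpace ComplexConjugate Matrix BigOperators
open Literature.Analysis Literature.Analysis.FunctionSpaces Literature.Analysis.FunctionSpaces.Torus
open Literature.Analysis.FluidPDE Literature.Analysis.FluidPDE.LatticeShear
open Summit.AnomalousDissipation.AnomalousDissipation.Theorems.SolenoidalFractalHomogenisation.PermissibleCarrier

variable {k₀ : ℕ}

set_option maxHeartbeats 1600000 in -- one period: `k₀` slot theorems, the invariant, the weighted period sum
/-- **One period of the principal pair (LOWER law).** Hypotheses: the per-slot data of `upperSome_period_invariant`, upper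
bounds of the slaving weights (`σ^o_j ≤ 2 + 2r`, `σ^i_j ≤ 2cos_j² + 26r`, cf. `slaving_weights_upper`), the isotropy identity of
the nominal polarisation form (cf. `isotropic_exponent_sum`) with constant `X`, and the cone / positivity at `qP`. Then:
the cone and positivity at `(q+1)P`; the per-period log law
`log x((q+1)P) ≥ log x(qP) − [Σ_j (2Λ_jτ_jd₀,j + slack_j + βη) + (1+ε)(1−4ρ/3)(X + (16κ + 26r)Σ_j 2Λ_jτ_jg₁,j²)]`,
`κ = e^{D₀P}(Σ_jδ_j)√(3η)`; and `x(t) ≥ x(qP)/2^{k₀+1}` on the period. -/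
theorem upperSome_period (W : LatticeWord k₀) {n : ℕ} (hn : 0 < n) {κ : ℝ} (hκ : 0 < κ)
    (ℓ : Fin 3 → ℤ) (hℓn : 2 * ‖latticeVec ℓ‖ ≤ n) {w₀ : UnitAddTorus (Fin 3) → EuclideanSpace ℝ (Fin 3)}
    (hw₀ : FunctionSpaces.Torus.MemSobolev 1 (FunctionSpaces.EuclideanSpace.complexify ∘ w₀))
    (hdiv : FunctionSpaces.Torus.IsWeaklyDivFree w₀) (hmean : FunctionSpaces.Torus.HasZeroMean w₀)
    (hsupp : ∀ k : Fin 3 → ℤ, ¬ ((∃ z : Fin 3 → ℤ, k = ℓ + (n:ℤ) • z) ∨ (∃ z : Fin 3 → ℤ, k = -ℓ + (n:ℤ) • z)) →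
      UnitAddTorus.mFourierCoeff (FunctionSpaces.EuclideanSpace.complexify ∘ w₀) k = 0)
    {N : ℕ} (hBN : (Finset.univ.biUnion fun j : Fin k₀ =>
        ({(fun i => (W.phase j).m i * n), -(fun i => (W.phase j).m i * n)} : Finset (Fin 3 → ℤ))) ⊆ freqBall N)
    (hk : ∀ j : Fin k₀, ∀ J : ℤ, ℓ + J • (fun i => (W.phase j).m i * (n : ℤ)) ∈ freqBall N →
      ℓ + J • (fun i => (W.phase j).m i * (n : ℤ)) ≠ 0)
    (hdisj : ∀ j : Fin k₀, ∀ J J' : ℤ,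
      ℓ + J • (fun i => (W.phase j).m i * (n : ℤ)) ≠ -(ℓ + J' • (fun i => (W.phase j).m i * (n : ℤ))))
    (ζr : Fin k₀ → Fin 3 → ℝ) (hζ1 : ∀ j, ζr j ⬝ᵥ ζr j = 1) (hζ0 : ∀ j, ζr j ⬝ᵥ (fun i => ((ℓ i : ℤ) : ℝ)) = 0)
    (hζK : ∀ j, ζr j ⬝ᵥ (fun i => (((fun i => (W.phase j).m i * (n : ℤ)) i : ℤ) : ℝ)) = 0)
    (pf : Fin k₀ → ℤ → Fin 3 → ℝ)
    (hp : ∀ j, ∀ J : ℤ, pf j J = (Real.sqrt ((fun i => (((ℓ + J • (fun i => (W.phase j).m i * (n : ℤ))) i : ℤ) : ℝ)) ⬝ᵥ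
        (fun i => (((ℓ + J • (fun i => (W.phase j).m i * (n : ℤ))) i : ℤ) : ℝ))))⁻¹ •
        (fun i => (((ℓ + J • (fun i => (W.phase j).m i * (n : ℤ))) i : ℤ) : ℝ)) ⨯₃ ζr j)
    (Wset : Fin k₀ → Finset ℤ)
    (hW : ∀ j, ∀ J : ℤ, J ∈ Wset j ↔ ℓ + J • (fun i => (W.phase j).m i * (n : ℤ)) ∈ freqBall N)
    (h0 : ∀ j, (0 : ℤ) ∈ Wset j) (h1 : ∀ j, (1 : ℤ) ∈ Wset j) (hm1 : ∀ j, (-1 : ℤ) ∈ Wset j)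
    (hs : ∀ j, ∀ J ∈ Wset j, |pf j J ⬝ᵥ pf j (J + 1)| ≤ 1)
    (Λ σo σi g₁ γ : Fin k₀ → ℝ) (Δ ε β : ℝ)
    (hΛ : ∀ j, Λ j = κ * (4 * Real.pi ^ 2 * freqNormSq (fun i => (W.phase j).m i * (n : ℤ))))
    (hΔ0 : 0 < Δ) (hε : 0 ≤ ε) (hβ : 0 ≤ β)
    (hgap : ∀ j, ∀ J ∈ Wset j, J ≠ 0 →
      freqNormSq ℓ / freqNormSq (fun i => (W.phase j).m i * (n : ℤ)) + Δ ≤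
        freqNormSq (ℓ + J • (fun i => (W.phase j).m i * (n : ℤ))) / freqNormSq (fun i => (W.phase j).m i * (n : ℤ)))
    (hσo : ∀ j, σo j = 1 / (freqNormSq (ℓ + (-1 : ℤ) • (fun i => (W.phase j).m i * (n : ℤ))) /
          freqNormSq (fun i => (W.phase j).m i * (n : ℤ)) - freqNormSq ℓ / freqNormSq (fun i => (W.phase j).m i * (n : ℤ))) +
        1 / (freqNormSq (ℓ + (1 : ℤ) • (fun i => (W.phase j).m i * (n : ℤ))) /
          freqNormSq (fun i => (W.phase j).m i * (n : ℤ)) - freqNormSq ℓ / freqNormSq (fun i => (W.phase j).m i * (n : ℤ))))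
    (hσi : ∀ j, σi j = (pf j (-1) ⬝ᵥ pf j 0) ^ 2 / (freqNormSq (ℓ + (-1 : ℤ) • (fun i => (W.phase j).m i * (n : ℤ))) /
          freqNormSq (fun i => (W.phase j).m i * (n : ℤ)) - freqNormSq ℓ / freqNormSq (fun i => (W.phase j).m i * (n : ℤ))) +
        (pf j 0 ⬝ᵥ pf j 1) ^ 2 / (freqNormSq (ℓ + (1 : ℤ) • (fun i => (W.phase j).m i * (n : ℤ))) /
          freqNormSq (fun i => (W.phase j).m i * (n : ℤ)) - freqNormSq ℓ / freqNormSq (fun i => (W.phase j).m i * (n : ℤ))))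
    (hγ : ∀ j, γ j ^ 2 = (pf j 0 ⬝ᵥ pf j 1) ^ 2 + (pf j (-1) ⬝ᵥ pf j 0) ^ 2) (hγ0 : ∀ j, 0 ≤ γ j)
    (hg₁ : ∀ j, g₁ j = 2 * Real.pi * (∑ i, (W.phase j).e i * (ℓ i : ℝ)) *
        ‖Complex.exp ((W.phase j).φ * Complex.I) *
          (1 / (2 * ((2 * Real.pi * ‖latticeVec (W.phase j).m‖ : ℝ) : ℂ) * Complex.I))‖ * (1 / (n : ℝ)) / Λ j)
    (hβo : ∀ j, 2 ≤ β * Δ * ε * σo j) (hβi : ∀ j, γ j ^ 2 ≤ β * Δ * ε * σi j)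
    (hsmallo : ∀ j, g₁ j ^ 2 * (4 * 2 / Δ + 2 * (1 + ε) * σo j) +
      2 * (4 * β * 2 * (Λ j * |g₁ j| ^ 3 * σo j + |g₁ j| / (W.ramp * (W.phase j).τ) + Λ j * |g₁ j| ^ 2) ^ 2 /
        (Λ j * Δ ^ 3)) / Λ j ≤ Δ)
    (hsmalli : ∀ j, g₁ j ^ 2 * (4 * γ j ^ 2 / Δ + 2 * (1 + ε) * σi j) +
      2 * (4 * β * γ j ^ 2 * (Λ j * |g₁ j| ^ 3 * σi j + |g₁ j| / (W.ramp * (W.phase j).τ) + Λ j * |g₁ j| ^ 2) ^ 2 /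
        (Λ j * Δ ^ 3)) / Λ j ≤ Δ)
    (hθo34 : ∀ j, 3 / 4 ≤ Real.exp (-(2 * Λ j * (W.phase j).τ * (freqNormSq ℓ / freqNormSq (fun i => (W.phase j).m i * (n : ℤ)) +
              (1 + ε) * σo j * (g₁ j ^ 2 * (1 - 4 * W.ramp / 3))) +
            40 * β * 2 * Λ j * (W.phase j).τ * g₁ j ^ 4 * (1 + g₁ j ^ 2 * σo j ^ 2) / Δ ^ 3 +
            48 * β * 2 * g₁ j ^ 2 / (W.ramp * (W.phase j).τ * Λ j * Δ ^ 3))))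
    (hθi34 : ∀ j, 3 / 4 ≤ Real.exp (-(2 * Λ j * (W.phase j).τ * (freqNormSq ℓ / freqNormSq (fun i => (W.phase j).m i * (n : ℤ)) +
              (1 + ε) * σi j * (g₁ j ^ 2 * (1 - 4 * W.ramp / 3))) +
            40 * β * γ j ^ 2 * Λ j * (W.phase j).τ * g₁ j ^ 4 * (1 + g₁ j ^ 2 * σi j ^ 2) / Δ ^ 3 +
            48 * β * γ j ^ 2 * g₁ j ^ 2 / (W.ramp * (W.phase j).τ * Λ j * Δ ^ 3))))
    (hθf : ∀ j, max (Real.exp (-(Λ j * Δ) * (W.phase j).τ))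
      (Real.exp (-(8 * Real.pi ^ 2 * κ * ((n : ℝ) / 2) ^ 2) * (W.phase j).τ)) ≤ 1 / 4)
    (η : ℝ) (hc : ∀ j, 12 * (2 * g₁ j ^ 2 * (2 + γ j ^ 2) / Δ ^ 2) ≤ η) (hη1 : η ≤ 1) (hβη : β * η ≤ 1 / 2)
    (rr X : ℝ) (hrr : 0 ≤ rr)
    (hσoU : ∀ j, σo j ≤ 2 + 2 * rr)
    (hσiU : ∀ j, σi j ≤ 2 * (((fun i => ((ℓ i : ℤ) : ℝ)) ⬝ᵥ (fun i => (((fun i => (W.phase j).m i * (n : ℤ)) i : ℤ) : ℝ))) ^ 2 /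
      (freqNormSq ℓ * freqNormSq (fun i => (W.phase j).m i * (n : ℤ)))) + 26 * rr)
    (hiso : ∀ b : EuclideanSpace ℂ (Fin 3), ∑ i, ((ℓ i : ℤ) : ℂ) * b i = 0 →
      ∑ j, 2 * (2 * Λ j * (W.phase j).τ * g₁ j ^ 2) * (‖inner ℂ (WithLp.toLp 2 (Complex.ofReal ∘ ζr j) : EuclideanSpace ℂ (Fin 3)) b‖ ^ 2 +
        ((fun i => ((ℓ i : ℤ) : ℝ)) ⬝ᵥ (fun i => (((fun i => (W.phase j).m i * (n : ℤ)) i : ℤ) : ℝ))) ^ 2 / (freqNormSq ℓ * freqNormSq (fun i => (W.phase j).m i * (n : ℤ))) *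
          ‖inner ℂ (WithLp.toLp 2 (Complex.ofReal ∘ pf j 0) : EuclideanSpace ℂ (Fin 3)) b‖ ^ 2) = X * ‖b‖ ^ 2)
    (q : ℕ)
    (hcone : ∑ k ∈ freqBall N, ‖(pvSetup_cell W hn hκ.le ℓ hw₀ hdiv hmean hsupp).galerkinCoeffAt N ((q : ℝ) * W.period) k‖ ^ 2 - 2 * ‖(pvSetup_cell W hn hκ.le ℓ hw₀ hdiv hmean hsupp).galerkinCoeffAt N ((q : ℝ) * W.period) ℓ‖ ^ 2 ≤ η * ‖(pvSetup_cell W hn hκ.le ℓ hw₀ hdiv hmean hsupp).galerkinCoeffAt N ((q : ℝ) * W.period) ℓ‖ ^ 2)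
    (hxpos : 0 < ‖(pvSetup_cell W hn hκ.le ℓ hw₀ hdiv hmean hsupp).galerkinCoeffAt N ((q : ℝ) * W.period) ℓ‖ ^ 2) :
    (∑ k ∈ freqBall N, ‖(pvSetup_cell W hn hκ.le ℓ hw₀ hdiv hmean hsupp).galerkinCoeffAt N (((q : ℝ) + 1) * W.period) k‖ ^ 2 - 2 * ‖(pvSetup_cell W hn hκ.le ℓ hw₀ hdiv hmean hsupp).galerkinCoeffAt N (((q : ℝ) + 1) * W.period) ℓ‖ ^ 2 ≤ η * ‖(pvSetup_cell W hn hκ.le ℓ hw₀ hdiv hmean hsupp).galerkinCoeffAt N (((q : ℝ) + 1) * W.period) ℓ‖ ^ 2 ∧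
      0 < ‖(pvSetup_cell W hn hκ.le ℓ hw₀ hdiv hmean hsupp).galerkinCoeffAt N (((q : ℝ) + 1) * W.period) ℓ‖ ^ 2) ∧
    Real.log (‖(pvSetup_cell W hn hκ.le ℓ hw₀ hdiv hmean hsupp).galerkinCoeffAt N ((q : ℝ) * W.period) ℓ‖ ^ 2) -
        ((∑ j, (2 * Λ j * (W.phase j).τ * (freqNormSq ℓ / freqNormSq (fun i => (W.phase j).m i * (n : ℤ))) + ((40 * β * 2 * Λ j * (W.phase j).τ * g₁ j ^ 4 * (1 + g₁ j ^ 2 * σo j ^ 2) / Δ ^ 3 + 48 * β * 2 * g₁ j ^ 2 / (W.ramp * (W.phase j).τ * Λ j * Δ ^ 3)) + (40 * β * γ j ^ 2 * Λ j * (W.phase j).τ * g₁ j ^ 4 * (1 + g₁ j ^ 2 * σi j ^ 2) / Δ ^ 3 + 48 * β * γ j ^ 2 * g₁ j ^ 2 / (W.ramp * (W.phase j).τ * Λ j * Δ ^ 3))) + β * η)) +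
          (1 + ε) * (1 - 4 * W.ramp / 3) * (X +
            (16 * (Real.exp (κ * (4 * Real.pi ^ 2 * freqNormSq ℓ) * W.period) * (∑ j, Real.exp (κ * (4 * Real.pi ^ 2 * freqNormSq ℓ) * (W.phase j).τ) * (Λ j * |g₁ j| * (Real.sqrt 2 + γ j)) * (W.phase j).τ) * Real.sqrt (3 * η)) +
              26 * rr) * ∑ j, 2 * Λ j * (W.phase j).τ * g₁ j ^ 2)) ≤
      Real.log (‖(pvSetup_cell W hn hκ.le ℓ hw₀ hdiv hmean hsupp).galerkinCoeffAt N (((q : ℝ) + 1) * W.period) ℓ‖ ^ 2) ∧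
    (∀ t ∈ Icc ((q : ℝ) * W.period) (((q : ℝ) + 1) * W.period), ‖(pvSetup_cell W hn hκ.le ℓ hw₀ hdiv hmean hsupp).galerkinCoeffAt N ((q : ℝ) * W.period) ℓ‖ ^ 2 / 2 ^ (k₀ + 1) ≤ ‖(pvSetup_cell W hn hκ.le ℓ hw₀ hdiv hmean hsupp).galerkinCoeffAt N t ℓ‖ ^ 2) := by
  classical
  set hPV := pvSetup_cell W hn hκ.le ℓ hw₀ hdiv hmean hsupp with hPVdef
  have hP : 0 < W.period := period_pos W
  have hq0 : 0 ≤ (q : ℝ) * W.period := by positivity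
  -- slot boundaries `T m = qP + Σ_{i<m} τ_i`
  set τ' : ℕ → ℝ := fun i => if h : i < k₀ then (W.phase ⟨i, h⟩).τ else 0 with hτ'
  set T : ℕ → ℝ := fun m => (q : ℝ) * W.period + ∑ i ∈ Finset.range m, τ' i with hT
  have hT0 : T 0 = (q : ℝ) * W.period := by simp [hT]
  have hTstart : ∀ m (hm : m < k₀), T m = (q : ℝ) * W.period + W.start ⟨m, hm⟩ := by
    intro m hm; simp only [hT, hτ']; rw [start_eq_sum_range W m hm]
  have hTsucc : ∀ m (hm : m < k₀), T (m + 1) = (q : ℝ) * W.period + W.start ⟨m, hm⟩ + (W.phase ⟨m, hm⟩).τ := by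
    intro m hm; simp only [hT, hτ']; rw [Finset.sum_range_succ, start_eq_sum_range W m hm, dif_pos hm, add_assoc]
  have hTk : T k₀ = ((q : ℝ) + 1) * W.period := by
    simp only [hT, hτ']; rw [← period_eq_sum_range W]; ring
  have hTmono : ∀ m (hm : m < k₀), T m ≤ T (m + 1) := fun m hm => by
    rw [hTstart m hm, hTsucc m hm]; linarith [(W.phase ⟨m, hm⟩).τ_pos]
  -- the invariant along the period
  have HI := upperSome_period_invariant W hn hκ ℓ hℓn hw₀ hdiv hmean hsupp hBN hk hdisj ζr hζ1 hζ0 hζK pf hp Wset hW h0 h1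
    hm1 hs Λ σo σi g₁ γ Δ ε β hΛ hΔ0 hε hβ hgap hσo hσi hγ hγ0 hg₁ hβo hβi hsmallo hsmalli hθo34 hθi34 hθf η hc hη1 hβη q
    hcone hxpos
  -- the slot theorem at slot `m`
  have HS : ∀ m (hm : m < k₀), _ := fun m hm => by
    obtain ⟨⟨hconem, hxm⟩, -, -⟩ := HI m hm.le
    have e := hTstart m hm
    simp only [hT, hτ'] at e
    rw [e] at hconem hxm
    exact upperSome_slot_step W hn hκ ℓ hℓn hw₀ hdiv hmean hsupp hBN q ⟨m, hm⟩ le_rfl (hk _) (hdisj _)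
      (hζ1 _) (hζ0 _) (hζK _) (hp _) (hW _) (h0 _) (h1 _) (hm1 _) (hs _) (Λ _) Δ ε β (σo _) (σi _) (g₁ _) (γ _) (hΛ _)
      hΔ0 hε hβ (hgap _) (hσo _) (hσi _) (hγ _) (hγ0 _) (hg₁ _) (hβo _) (hβi _) (hsmallo _) (hsmalli _) (hθo34 _)
      (hθi34 _) (hθf _) η (hc _) hη1 hβη hconem hxm

  -- sums over `Fin k₀` as sums over `range k₀`
  have toRange : ∀ g : Fin k₀ → ℝ, ∑ j, g j = ∑ i ∈ Finset.range k₀, (if h : i < k₀ then g ⟨i, h⟩ else 0) := by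
    intro g
    rw [← Fin.sum_univ_eq_sum_range (fun i => if h : i < k₀ then g ⟨i, h⟩ else 0) k₀]
    refine Finset.sum_congr rfl fun i _ => ?_
    simp [i.isLt]
  have eP : ∑ i ∈ Finset.range k₀, τ' i = W.period := by simp only [hτ']; exact (period_eq_sum_range W).symm
  -- 1. cone and positivity at the end of the period
  have hend := (HI k₀ le_rfl).1
  have eTk : (q : ℝ) * W.period + ∑ i ∈ Finset.range k₀, (if h : i < k₀ then (W.phase ⟨i, h⟩).τ else 0) =
      ((q : ℝ) + 1) * W.period := by
    have := hTk; simp only [hT, hτ'] at this; exact this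
  rw [eTk] at hend
  refine ⟨hend, ?_, ?_⟩
  · -- 2. the telescoped log law
    set f : ℕ → ℝ := fun m => Real.log (‖hPV.galerkinCoeffAt N (T m) ℓ‖ ^ 2) with hf
    set Wt : ℕ → ℝ := fun m => if h : m < k₀ then
        (‖inner ℂ (WithLp.toLp 2 (Complex.ofReal ∘ ζr ⟨m, h⟩) : EuclideanSpace ℂ (Fin 3)) (hPV.galerkinCoeffAt N (T m) ℓ)‖ ^ 2 /
            ‖hPV.galerkinCoeffAt N (T m) ℓ‖ ^ 2 * σo ⟨m, h⟩ +
          ‖inner ℂ (WithLp.toLp 2 (Complex.ofReal ∘ pf ⟨m, h⟩ 0) : EuclideanSpace ℂ (Fin 3)) (hPV.galerkinCoeffAt N (T m) ℓ)‖ ^ 2 /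
            ‖hPV.galerkinCoeffAt N (T m) ℓ‖ ^ 2 * σi ⟨m, h⟩) else 0 with hWt
    set Aj : Fin k₀ → ℝ := fun j => 2 * Λ j * (W.phase j).τ * g₁ j ^ 2 with hAj
    set Bj : Fin k₀ → ℝ := fun j => 2 * Λ j * (W.phase j).τ * (freqNormSq ℓ / freqNormSq (fun i => (W.phase j).m i * (n : ℤ))) +
      ((40 * β * 2 * Λ j * (W.phase j).τ * g₁ j ^ 4 * (1 + g₁ j ^ 2 * σo j ^ 2) / Δ ^ 3 +
          48 * β * 2 * g₁ j ^ 2 / (W.ramp * (W.phase j).τ * Λ j * Δ ^ 3)) +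
        (40 * β * γ j ^ 2 * Λ j * (W.phase j).τ * g₁ j ^ 4 * (1 + g₁ j ^ 2 * σi j ^ 2) / Δ ^ 3 +
          48 * β * γ j ^ 2 * g₁ j ^ 2 / (W.ramp * (W.phase j).τ * Λ j * Δ ^ 3))) + β * η with hBj
    have hρ3 : 0 ≤ 1 - 4 * W.ramp / 3 := by have := W.ramp_le; linarith
    have hstep : ∀ m ∈ Finset.range k₀, -(if h : m < k₀ then Bj ⟨m, h⟩ else 0) -
        (1 + ε) * (1 - 4 * W.ramp / 3) * ((if h : m < k₀ then Aj ⟨m, h⟩ else 0) * Wt m) ≤ f (m + 1) - f m := by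
      intro m hm''
      have hm : m < k₀ := Finset.mem_range.1 hm''
      obtain ⟨-, ⟨hsplit, hlog⟩, -, -⟩ := HS m hm
      simp only [dif_pos hm, hWt, hf, hAj, hBj]
      rw [hTsucc m hm, hTstart m hm]
      set xa := ‖hPV.galerkinCoeffAt N ((q : ℝ) * W.period + W.start ⟨m, hm⟩) ℓ‖ ^ 2 with hxa
      set Eo := ‖inner ℂ (WithLp.toLp 2 (Complex.ofReal ∘ ζr ⟨m, hm⟩) : EuclideanSpace ℂ (Fin 3))
        (hPV.galerkinCoeffAt N ((q : ℝ) * W.period + W.start ⟨m, hm⟩) ℓ)‖ ^ 2 with hEo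
      set Ei := ‖inner ℂ (WithLp.toLp 2 (Complex.ofReal ∘ pf ⟨m, hm⟩ 0) : EuclideanSpace ℂ (Fin 3))
        (hPV.galerkinCoeffAt N ((q : ℝ) * W.period + W.start ⟨m, hm⟩) ℓ)‖ ^ 2 with hEi
      have hxapos : 0 < xa := by
        obtain ⟨⟨-, hxm⟩, -, -⟩ := HI m hm.le
        have e := hTstart m hm; simp only [hT, hτ'] at e; rw [e] at hxm; exact hxm
      rw [Real.log_exp, Real.log_exp] at hlog
      have hwo0 : 0 ≤ Eo / xa := div_nonneg (sq_nonneg _) hxapos.le; have hwi0 : 0 ≤ Ei / xa := div_nonneg (sq_nonneg _) hxapos.le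
      have hws : Eo / xa + Ei / xa = 1 := by rw [← add_div, ← hsplit, div_self hxapos.ne']
      have hΛ0 : 0 < Λ ⟨m, hm⟩ := by rw [hΛ]; exact cellRate_pos _ hn hκ
      have hτ0 := (W.phase ⟨m, hm⟩).τ_pos; have hρ0 := W.ramp_pos
      have hS1 : 0 ≤ 40 * β * 2 * Λ ⟨m, hm⟩ * (W.phase ⟨m, hm⟩).τ * g₁ ⟨m, hm⟩ ^ 4 * (1 + g₁ ⟨m, hm⟩ ^ 2 * σo ⟨m, hm⟩ ^ 2) / Δ ^ 3 := by
        positivity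
      have hS2 : 0 ≤ 48 * β * 2 * g₁ ⟨m, hm⟩ ^ 2 / (W.ramp * (W.phase ⟨m, hm⟩).τ * Λ ⟨m, hm⟩ * Δ ^ 3) := by positivity
      have hS3 : 0 ≤ 40 * β * γ ⟨m, hm⟩ ^ 2 * Λ ⟨m, hm⟩ * (W.phase ⟨m, hm⟩).τ * g₁ ⟨m, hm⟩ ^ 4 *
          (1 + g₁ ⟨m, hm⟩ ^ 2 * σi ⟨m, hm⟩ ^ 2) / Δ ^ 3 := by positivity
      have hS4 : 0 ≤ 48 * β * γ ⟨m, hm⟩ ^ 2 * g₁ ⟨m, hm⟩ ^ 2 / (W.ramp * (W.phase ⟨m, hm⟩).τ * Λ ⟨m, hm⟩ * Δ ^ 3) := by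
        positivity
      generalize 40 * β * 2 * Λ ⟨m, hm⟩ * (W.phase ⟨m, hm⟩).τ * g₁ ⟨m, hm⟩ ^ 4 * (1 + g₁ ⟨m, hm⟩ ^ 2 * σo ⟨m, hm⟩ ^ 2) / Δ ^ 3 = S1
        at hS1 hlog ⊢
      generalize 48 * β * 2 * g₁ ⟨m, hm⟩ ^ 2 / (W.ramp * (W.phase ⟨m, hm⟩).τ * Λ ⟨m, hm⟩ * Δ ^ 3) = S2 at hS2 hlog ⊢
      generalize 40 * β * γ ⟨m, hm⟩ ^ 2 * Λ ⟨m, hm⟩ * (W.phase ⟨m, hm⟩).τ * g₁ ⟨m, hm⟩ ^ 4 *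
          (1 + g₁ ⟨m, hm⟩ ^ 2 * σi ⟨m, hm⟩ ^ 2) / Δ ^ 3 = S3 at hS3 hlog ⊢
      generalize 48 * β * γ ⟨m, hm⟩ ^ 2 * g₁ ⟨m, hm⟩ ^ 2 / (W.ramp * (W.phase ⟨m, hm⟩).τ * Λ ⟨m, hm⟩ * Δ ^ 3) = S4 at hS4 hlog ⊢
      generalize Eo / xa = wo at hwo0 hws hlog ⊢
      generalize Ei / xa = wi at hwi0 hws hlog ⊢
      have hwo1 : wo ≤ 1 := (by linarith); have hwi1 : wi ≤ 1 := (by linarith)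
      have t1 : wo * S1 ≤ S1 := (by nlinarith); have t2 : wo * S2 ≤ S2 := (by nlinarith)
      have t3 : wi * S3 ≤ S3 := (by nlinarith); have t4 : wi * S4 ≤ S4 := (by nlinarith)
      have e1 : wo * -(2 * Λ ⟨m, hm⟩ * (W.phase ⟨m, hm⟩).τ *
            (freqNormSq ℓ / freqNormSq (fun i => (W.phase ⟨m, hm⟩).m i * (n : ℤ)) +
              (1 + ε) * σo ⟨m, hm⟩ * (g₁ ⟨m, hm⟩ ^ 2 * (1 - 4 * W.ramp / 3))) + S1 + S2) +
          wi * -(2 * Λ ⟨m, hm⟩ * (W.phase ⟨m, hm⟩).τ *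
            (freqNormSq ℓ / freqNormSq (fun i => (W.phase ⟨m, hm⟩).m i * (n : ℤ)) +
              (1 + ε) * σi ⟨m, hm⟩ * (g₁ ⟨m, hm⟩ ^ 2 * (1 - 4 * W.ramp / 3))) + S3 + S4) =
          -((wo + wi) * (2 * Λ ⟨m, hm⟩ * (W.phase ⟨m, hm⟩).τ *
            (freqNormSq ℓ / freqNormSq (fun i => (W.phase ⟨m, hm⟩).m i * (n : ℤ))))) -
            (1 + ε) * (1 - 4 * W.ramp / 3) * (2 * Λ ⟨m, hm⟩ * (W.phase ⟨m, hm⟩).τ * g₁ ⟨m, hm⟩ ^ 2 *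
              (wo * σo ⟨m, hm⟩ + wi * σi ⟨m, hm⟩)) - (wo * S1 + wo * S2 + wi * S3 + wi * S4) := by ring
      rw [e1, hws, one_mul] at hlog
      linarith
    have hsum := Finset.sum_le_sum hstep
    rw [Finset.sum_range_sub, Finset.sum_sub_distrib, Finset.sum_neg_distrib, ← Finset.mul_sum] at hsum
    have ef0 : f 0 = Real.log (‖hPV.galerkinCoeffAt N ((q : ℝ) * W.period) ℓ‖ ^ 2) := by simp only [hf, hT0]
    rw [ef0, show f k₀ = Real.log (‖hPV.galerkinCoeffAt N (((q : ℝ) + 1) * W.period) ℓ‖ ^ 2) by simp only [hf, hTk]] at hsum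
    have eB : ∑ i ∈ Finset.range k₀, (if h : i < k₀ then Bj ⟨i, h⟩ else 0) = ∑ j, Bj j := (toRange Bj).symm
    rw [eB] at hsum
    have hAW : ∑ i ∈ Finset.range k₀, (if h : i < k₀ then Aj ⟨i, h⟩ else 0) * Wt i ≤
        X + (16 * (Real.exp (κ * (4 * Real.pi ^ 2 * freqNormSq ℓ) * W.period) *
          (∑ j, Real.exp (κ * (4 * Real.pi ^ 2 * freqNormSq ℓ) * (W.phase j).τ) * (Λ j * |g₁ j| * (Real.sqrt 2 + γ j)) *
            (W.phase j).τ) * Real.sqrt (3 * η)) + 26 * rr) * ∑ j, Aj j := by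
      set v : ℕ → EuclideanSpace ℂ (Fin 3) := fun m => hPV.galerkinCoeffAt N (T m) ℓ with hv
      set ζc : ℕ → EuclideanSpace ℂ (Fin 3) := fun m => if h : m < k₀ then WithLp.toLp 2 (Complex.ofReal ∘ ζr ⟨m, h⟩) else 0
        with hζc
      set πc : ℕ → EuclideanSpace ℂ (Fin 3) := fun m => if h : m < k₀ then WithLp.toLp 2 (Complex.ofReal ∘ pf ⟨m, h⟩ 0) else 0
        with hπc
      set A' : ℕ → ℝ := fun m => if h : m < k₀ then Aj ⟨m, h⟩ else 0 with hA'
      set cc : ℕ → ℝ := fun m => if h : m < k₀ then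
        ((fun i => ((ℓ i : ℤ) : ℝ)) ⬝ᵥ (fun i => (((fun i => (W.phase ⟨m, h⟩).m i * (n : ℤ)) i : ℤ) : ℝ))) ^ 2 /
          (freqNormSq ℓ * freqNormSq (fun i => (W.phase ⟨m, h⟩).m i * (n : ℤ))) else 0 with hcc
      set σo' : ℕ → ℝ := fun m => if h : m < k₀ then σo ⟨m, h⟩ else 0 with hσo'
      set σi' : ℕ → ℝ := fun m => if h : m < k₀ then σi ⟨m, h⟩ else 0 with hσi'
      set sc : ℕ → ℝ := fun m => Real.exp (κ * (4 * Real.pi ^ 2 * freqNormSq ℓ) * ∑ i ∈ Finset.range m, τ' i) with hsc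
      set κd : ℝ := Real.exp (κ * (4 * Real.pi ^ 2 * freqNormSq ℓ) * W.period) *
          (∑ j, Real.exp (κ * (4 * Real.pi ^ 2 * freqNormSq ℓ) * (W.phase j).τ) * (Λ j * |g₁ j| * (Real.sqrt 2 + γ j)) *
            (W.phase j).τ) * Real.sqrt (3 * η) with hκd
      have hv0 : v 0 ≠ 0 := fun h0' => by
        have : ‖hPV.galerkinCoeffAt N (T 0) ℓ‖ ^ 2 = 0 := by simp only [hv] at h0'; rw [h0']; simp
        rw [hT0] at this; linarith
      have hvm : ∀ m < k₀, v m ≠ 0 := by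
        intro m hm h0'
        obtain ⟨⟨-, hxm⟩, -, -⟩ := HI m hm.le
        have e := hTstart m hm; simp only [hT, hτ'] at e
        have : ‖hPV.galerkinCoeffAt N (T m) ℓ‖ ^ 2 = 0 := by simp only [hv] at h0'; rw [h0']; simp
        rw [hTstart m hm] at this; rw [e] at hxm; linarith
      have hnormζ : ∀ m < k₀, ‖ζc m‖ ≤ 1 := by
        intro m hm; simp only [hζc, dif_pos hm]
        have h1 : ‖(WithLp.toLp 2 (Complex.ofReal ∘ ζr ⟨m, hm⟩) : EuclideanSpace ℂ (Fin 3))‖ ^ 2 = ζr ⟨m, hm⟩ ⬝ᵥ ζr ⟨m, hm⟩ := by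
          rw [EuclideanSpace.norm_sq_eq, dotProduct]
          refine Finset.sum_congr rfl fun i _ => ?_
          simp [sq]
        rw [hζ1] at h1
        nlinarith [norm_nonneg (WithLp.toLp 2 (Complex.ofReal ∘ ζr ⟨m, hm⟩) : EuclideanSpace ℂ (Fin 3))]
      have hnormπ : ∀ m < k₀, ‖πc m‖ ≤ 1 := by
        intro m hm; simp only [hπc, dif_pos hm]
        have h1 : ‖(WithLp.toLp 2 (Complex.ofReal ∘ pf ⟨m, hm⟩ 0) : EuclideanSpace ℂ (Fin 3))‖ ^ 2 = pf ⟨m, hm⟩ 0 ⬝ᵥ pf ⟨m, hm⟩ 0 := by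
          rw [EuclideanSpace.norm_sq_eq, dotProduct]
          refine Finset.sum_congr rfl fun i _ => ?_
          simp [sq]
        have hp0 : pf ⟨m, hm⟩ 0 ⬝ᵥ pf ⟨m, hm⟩ 0 ≤ 1 := by
          rw [hp ⟨m, hm⟩ 0]
          exact inPlane_dot_self_le_one _ (hζ1 _) (zeta_dot_coset (hζ0 _) (hζK _) 0)
        nlinarith [norm_nonneg (WithLp.toLp 2 (Complex.ofReal ∘ pf ⟨m, hm⟩ 0) : EuclideanSpace ℂ (Fin 3))]
      have hA0 : ∀ m < k₀, 0 ≤ A' m := by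
        intro m hm; simp only [hA', dif_pos hm, hAj]
        have hΛ0 : 0 < Λ ⟨m, hm⟩ := by rw [hΛ]; exact cellRate_pos _ hn hκ
        have := (W.phase ⟨m, hm⟩).τ_pos
        positivity
      have hcc01 : ∀ m < k₀, 0 ≤ cc m ∧ cc m ≤ 1 := by
        intro m hm; simp only [hcc, dif_pos hm]
        refine ⟨div_nonneg (sq_nonneg _) (mul_nonneg (freqNormSq_nonneg _) (freqNormSq_nonneg _)), ?_⟩
        exact dot_sq_div_freqNormSq_le_one ℓ _
      have hσo'U : ∀ m < k₀, σo' m ≤ 2 + 2 * rr := by intro m hm; simp only [hσo', dif_pos hm]; exact hσoU _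
      have hσi'U : ∀ m < k₀, σi' m ≤ 2 * cc m + 26 * rr := by
        intro m hm; simp only [hσi', hcc, dif_pos hm]; exact hσiU _
      have hs : ∀ m < k₀, 0 < sc m := fun m _ => Real.exp_pos _
      have hdrift : ∀ m < k₀, ‖((sc m : ℝ) : ℂ) • v m - v 0‖ ≤ κd * ‖v 0‖ := by
        intro m hm
        obtain ⟨-, -, hd⟩ := HI m hm.le
        simp only [hsc, hv, hT, hτ'] at hd ⊢
        simp only [Finset.range_zero, Finset.sum_empty, add_zero]
        refine hd.trans ?_
        rw [hκd]
        have hη0 : 0 ≤ η := le_trans (by have := hΔ0; positivity) (hc ⟨0, W.pos⟩)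
        have hsq : Real.sqrt (3 * η * ‖hPV.galerkinCoeffAt N ((q : ℝ) * W.period) ℓ‖ ^ 2) =
            Real.sqrt (3 * η) * ‖hPV.galerkinCoeffAt N ((q : ℝ) * W.period) ℓ‖ := by
          rw [Real.sqrt_mul (by positivity), Real.sqrt_sq (norm_nonneg _)]
        rw [hsq]
        have hδnn : ∀ i : ℕ, 0 ≤ (if h : i < k₀ then Real.exp (κ * (4 * Real.pi ^ 2 * freqNormSq ℓ) * (W.phase ⟨i, h⟩).τ) *
            (Λ ⟨i, h⟩ * |g₁ ⟨i, h⟩| * (Real.sqrt 2 + γ ⟨i, h⟩)) * (W.phase ⟨i, h⟩).τ else 0) := by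
          intro i; split_ifs with h
          · have := (W.phase ⟨i, h⟩).τ_pos; have := hγ0 ⟨i, h⟩
            have hΛ0 : 0 < Λ ⟨i, h⟩ := by rw [hΛ]; exact cellRate_pos _ hn hκ
            positivity
          · exact le_rfl
        have hpart : (∑ i ∈ Finset.range m, (if h : i < k₀ then Real.exp (κ * (4 * Real.pi ^ 2 * freqNormSq ℓ) * (W.phase ⟨i, h⟩).τ) *
            (Λ ⟨i, h⟩ * |g₁ ⟨i, h⟩| * (Real.sqrt 2 + γ ⟨i, h⟩)) * (W.phase ⟨i, h⟩).τ else 0)) ≤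
            ∑ j, Real.exp (κ * (4 * Real.pi ^ 2 * freqNormSq ℓ) * (W.phase j).τ) * (Λ j * |g₁ j| * (Real.sqrt 2 + γ j)) *
              (W.phase j).τ := by
          rw [toRange]
          exact Finset.sum_le_sum_of_subset_of_nonneg (Finset.range_mono hm.le) fun i _ _ => hδnn i
        have hE0 : 0 ≤ Real.exp (κ * (4 * Real.pi ^ 2 * freqNormSq ℓ) * W.period) := (Real.exp_pos _).le
        have h3 : 0 ≤ Real.sqrt (3 * η) * ‖hPV.galerkinCoeffAt N ((q : ℝ) * W.period) ℓ‖ := by positivity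
        calc Real.exp (κ * (4 * Real.pi ^ 2 * freqNormSq ℓ) * W.period) *
              (∑ i ∈ Finset.range m, (if h : i < k₀ then Real.exp (κ * (4 * Real.pi ^ 2 * freqNormSq ℓ) * (W.phase ⟨i, h⟩).τ) *
                (Λ ⟨i, h⟩ * |g₁ ⟨i, h⟩| * (Real.sqrt 2 + γ ⟨i, h⟩)) * (W.phase ⟨i, h⟩).τ else 0)) *
              (Real.sqrt (3 * η) * ‖hPV.galerkinCoeffAt N ((q : ℝ) * W.period) ℓ‖)
            ≤ Real.exp (κ * (4 * Real.pi ^ 2 * freqNormSq ℓ) * W.period) *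
              (∑ j, Real.exp (κ * (4 * Real.pi ^ 2 * freqNormSq ℓ) * (W.phase j).τ) * (Λ j * |g₁ j| * (Real.sqrt 2 + γ j)) *
                (W.phase j).τ) * (Real.sqrt (3 * η) * ‖hPV.galerkinCoeffAt N ((q : ℝ) * W.period) ℓ‖) :=
              mul_le_mul_of_nonneg_right (mul_le_mul_of_nonneg_left hpart hE0) h3
          _ = _ := by ring
      have hsplit' : ∀ m < k₀, ‖inner ℂ (ζc m) (v m)‖ ^ 2 + ‖inner ℂ (πc m) (v m)‖ ^ 2 = ‖v m‖ ^ 2 := by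
        intro m hm
        obtain ⟨-, ⟨hsp, -⟩, -, -⟩ := HS m hm
        simp only [hζc, hπc, hv, dif_pos hm]
        rw [hTstart m hm]
        exact hsp.symm
      have hiso' : ∑ m ∈ Finset.range k₀, 2 * A' m * (‖inner ℂ (ζc m) (((‖v 0‖⁻¹ : ℝ) : ℂ) • v 0)‖ ^ 2 +
          cc m * ‖inner ℂ (πc m) (((‖v 0‖⁻¹ : ℝ) : ℂ) • v 0)‖ ^ 2) = X := by
        have hb : ∑ i, ((ℓ i : ℤ) : ℂ) * (((‖v 0‖⁻¹ : ℝ) : ℂ) • v 0) i = 0 := by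
          have h := hPV.sum_mul_galerkinCoeffAt N (T 0) ℓ
          simp only [hv, PiLp.smul_apply, smul_eq_mul]
          have e : ∑ i, ((ℓ i : ℤ) : ℂ) * (((‖hPV.galerkinCoeffAt N (T 0) ℓ‖⁻¹ : ℝ) : ℂ) * (hPV.galerkinCoeffAt N (T 0) ℓ) i) =
              ((‖hPV.galerkinCoeffAt N (T 0) ℓ‖⁻¹ : ℝ) : ℂ) * ∑ i, ((ℓ i : ℤ) : ℂ) * (hPV.galerkinCoeffAt N (T 0) ℓ) i := by
            rw [Finset.mul_sum]; refine Finset.sum_congr rfl fun i _ => ?_; ring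
          rw [e, h, mul_zero]
        have h := hiso _ hb
        have hnorm : ‖((‖v 0‖⁻¹ : ℝ) : ℂ) • v 0‖ = 1 := by
          rw [norm_smul, Complex.norm_real, Real.norm_eq_abs, abs_of_pos (inv_pos.2 (norm_pos_iff.2 hv0)),
            inv_mul_cancel₀ (norm_pos_iff.2 hv0).ne']
        rw [hnorm, one_pow, mul_one, toRange] at h
        refine Eq.trans (Finset.sum_congr rfl fun m hm'' => ?_) h
        have hm : m < k₀ := Finset.mem_range.1 hm''
        simp only [hA', hζc, hπc, hcc, hAj, dif_pos hm]
      have hmain := period_weighted_sum_le k₀ ζc πc A' cc σo' σi' sc v X rr κd hnormζ hnormπ hA0 hcc01 hrr hσo'U hσi'U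
        hvm hv0 hs hdrift hsplit' hiso'
      have eA : ∑ m ∈ Finset.range k₀, A' m = ∑ j, Aj j := by rw [toRange]
      rw [eA] at hmain
      refine le_trans (le_of_eq ?_) hmain
      refine Finset.sum_congr rfl fun m hm'' => ?_
      have hm : m < k₀ := Finset.mem_range.1 hm''
      simp only [hA', hWt, hσo', hσi', hζc, hπc, hv, dif_pos hm]
    have hfac : 0 ≤ (1 + ε) * (1 - 4 * W.ramp / 3) := by positivity
    have := mul_le_mul_of_nonneg_left hAW hfac
    simp only [hAj, hBj] at hsum this ⊢
    linarith
  · -- 4. the interior bound over the period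
    have hclaim : ∀ m, m ≤ k₀ → ‖hPV.galerkinCoeffAt N ((q : ℝ) * W.period) ℓ‖ ^ 2 / 2 ^ m ≤ ‖hPV.galerkinCoeffAt N (T m) ℓ‖ ^ 2 ∧
        ∀ t ∈ Icc ((q : ℝ) * W.period) (T m), ‖hPV.galerkinCoeffAt N ((q : ℝ) * W.period) ℓ‖ ^ 2 / 2 ^ (k₀ + 1) ≤
          ‖hPV.galerkinCoeffAt N t ℓ‖ ^ 2 := by
      intro m
      induction m with
      | zero =>
        intro _
        refine ⟨by rw [hT0]; simp, fun t ht => ?_⟩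
        rw [hT0] at ht
        rw [show t = (q : ℝ) * W.period from le_antisymm ht.2 ht.1]
        exact div_le_self (sq_nonneg _) (one_le_pow₀ (by norm_num))
      | succ m ih =>
        intro hm
        have hm' : m < k₀ := Nat.lt_of_succ_le hm
        obtain ⟨ihx, iht⟩ := ih hm'.le
        obtain ⟨-, -, hint, -⟩ := HS m hm'
        rw [← hTsucc m hm', ← hTstart m hm'] at hint
        have hxm1 : ‖hPV.galerkinCoeffAt N ((q : ℝ) * W.period) ℓ‖ ^ 2 / 2 ^ (m + 1) ≤ ‖hPV.galerkinCoeffAt N (T (m + 1)) ℓ‖ ^ 2 := by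
          have h := hint (T (m + 1)) ⟨hTmono m hm', le_rfl⟩
          have e : (2 : ℝ) ^ (m + 1) = 2 ^ m * 2 := pow_succ 2 m
          rw [e, ← div_div]
          have := div_le_div_of_nonneg_right ihx (by norm_num : (0:ℝ) ≤ 2)
          linarith
        refine ⟨hxm1, fun t ht => ?_⟩
        by_cases htm : t ≤ T m
        · exact iht t ⟨ht.1, htm⟩
        · have h := hint t ⟨(not_le.1 htm).le, ht.2⟩
          have hpow : ‖hPV.galerkinCoeffAt N ((q : ℝ) * W.period) ℓ‖ ^ 2 / 2 ^ (k₀ + 1) ≤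
              ‖hPV.galerkinCoeffAt N ((q : ℝ) * W.period) ℓ‖ ^ 2 / 2 ^ m / 2 := by
            rw [div_div, ← pow_succ]
            exact div_le_div_of_nonneg_left (sq_nonneg _) (by positivity) (pow_le_pow_right₀ (by norm_num) (by omega))
          linarith
    have h := (hclaim k₀ le_rfl).2
    rw [hTk] at h
    exact h

end Summit.AnomalousDissipation.AnomalousDissipation.Theorems.SolenoidalFractalHomogenisation.RealisedQuasiStaticCellLaw

end
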